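import Literature.Analysis.FluidPDE.TorusLpOperatorFacts
import Literature.Analysis.FluidPDE.FracLaplacianSmooth
import Literature.Analysis.FunctionSpaces.TorusHeatSmoothing
import Mathlib.Analysis.SpecialFunctions.ImproperIntegrals
import Mathlib.MeasureTheory.Integral.IntegralEqImproper
import Mathlib.Analysis.SpecialFunctions.Pow.Asymptotics
import HarnessLib

/-!
# The moment inequality for the fractional Laplacian on `L^p(T^d)`: discharge of
  `Torus.fracLaplacian_moment_bound`

Analysis/FluidPDE proof file, sibling of `TorusLpOperatorFacts` (the named fact
`Literature.Analysis.FluidPDE.Torus.fracLaplacian_moment_bound d`: A. Pazy, *Semigroups of Linear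
Operators and Applications to PDE* (1983), §2.6 **Theorem 6.10**, (6.18)–(6.19) — for
`0 < α < 1` there is `C₀` with `‖A^α x‖ ≤ C₀(ρ^α‖x‖ + ρ^{α-1}‖Ax‖)` for all `ρ > 0` and
`‖A^α x‖ ≤ 2C₀‖x‖^{1-α}‖Ax‖^α`, `x ∈ D(A)` — applied to `A = -Δ` on `L^p(T^d)`, `1 < p < ∞`,
whose fractional power on smooth fields is the spectral `Torus.fracLaplacian α`). This file PROVES

* `Torus.fracLaplacian_moment_bound_holds : fracLaplacian_moment_bound d`

for every finite index type `d`, with a constant depending on `α` only.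

## The argument (Pazy's splitting, with the semigroup in place of the resolvent)

Pazy proves (6.18) from the resolvent formula `A^α x = (sin πα/π)∫₀^∞ t^{α-1}A(t+A)⁻¹x dt`
(Thm. 6.9), splitting the integral at `t = ρ` and using `‖A(t+A)⁻¹‖ ≤ 1 + M`, `‖(t+A)⁻¹‖ ≤ M/t`.
We run the same splitting on the semigroup formula

  `(-Δ)^α u = I_α⁻¹ ∫₀^∞ s^{-1-α} (u - e^{sΔ}u) ds`,  `I_α = ∫₀^∞ t^{-1-α}(1 - e^{-t}) dt ∈ (0, ∞)`

(`Torus.integral_rpow_smul_sub_heatSmoothing`; on the Fourier side this is the scalar identity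
`λ^α I_α = ∫₀^∞ s^{-1-α}(1 - e^{-sλ}) ds`, `λ = 4π²|k|²`, integrated against the absolutely
convergent Fourier series of `u`), where `e^{sΔ}u(x) = ∫_{ℝ^d} G_s(z) u(x - proj z) dz` is the heat
smoothing of `FunctionSpaces/TorusHeatSmoothing`, which supplies the two semigroup bounds
`‖e^{sΔ}u‖_p ≤ ‖u‖_p` and `‖u - e^{sΔ}u‖_p ≤ s‖Δu‖_p`. Minkowski's inequality in the time
variable (the tree's Minkowski–Jensen lemma `FunctionSpaces.eLpNorm_integral_smul_le_mul`) on
`(0, ρ]` and on `(ρ, ∞)` gives Pazy's (6.18) in the form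

  `‖(-Δ)^α u‖_p ≤ I_α⁻¹ (ρ^{1-α}/(1-α) ‖Δu‖_p + 2ρ^{-α}/α ‖u‖_p)`   (`ρ > 0`)

(`Torus.eLpNorm_fracLaplacian_le_of_pos`), and the choice `ρ = ‖u‖_p/‖Δu‖_p` (limits `ρ → 0⁺`,
`ρ → ∞` in the degenerate cases) gives (6.19) with `C = I_α⁻¹(1/(1-α) + 2/α)`.

## Mathlib / tree search

Mathlib: `integral_comp_mul_left_Ioi`, `integral_Ioi_rpow_of_lt`, `integral_rpow`,
`integral_tsum`, `setIntegral_pos_iff_support_of_nonneg_ae`; no fractional powers of operators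
(searched `Balakrishnan`, `moment inequality`, `fractional power`: nothing relevant). Tree:
`Torus.hasSum_fracLaplacian`, `Torus.summable_fracSymbol_mul_norm` (`FracLaplacianSmooth`), the
heat-smoothing file above, `FunctionSpaces.eLpNorm_integral_smul_le_mul` (`TorusMollifierEstimates`).

## References

* A. Pazy, *Semigroups of Linear Operators and Applications to Partial Differential Equations*,
  Applied Math. Sciences 44, Springer 1983: §2.6 Thm. 6.9, **Thm. 6.10 (6.18)–(6.19)** (book
  p. 73), §1.2 Thm. 2.4 (d). [`Pazy1983`]
* T. Luo, E. S. Titi, Calc. Var. PDE 59 (2020) = arXiv:1808.07595, (3.20) (consumer). [`LuoTiti2020`]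
-/

noncomputable section

open MeasureTheory Set Filter Function UnitAddTorus
open Literature.Analysis.UnboundedOperators
open scoped ENNReal NNReal ContDiff Topology

namespace Literature.Analysis.FluidPDE

namespace Torus

open FunctionSpaces FunctionSpaces.Torus

/-! ## The scalar weight `t^{-1-α}(1 - e^{-tλ})` -/

section Scalar

variable {α : ℝ}

/-- The weight `t^{-1-α}(1 - e^{-tλ})` is nonnegative for `t ≥ 0`, `λ ≥ 0`. [folklore] -/
theorem momentWeight_nonneg (α : ℝ) {l t : ℝ} (hl : 0 ≤ l) (ht : 0 ≤ t) :
    0 ≤ t ^ (-1 - α) * (1 - Real.exp (-(t * l))) := by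
  refine mul_nonneg (Real.rpow_nonneg ht _) ?_
  rw [sub_nonneg, Real.exp_le_one_iff, neg_nonpos]
  exact mul_nonneg ht hl

/-- **Integrability of the weight**: for `0 < α < 1` and `λ ≥ 0`, `t ↦ t^{-1-α}(1 - e^{-tλ})` is
integrable on `(0, ∞)` (near `0` it is `≤ λ t^{-α}`, near `∞` it is `≤ t^{-1-α}`). [folklore] -/
theorem integrableOn_momentWeight (hα0 : 0 < α) (hα1 : α < 1) {l : ℝ} (hl : 0 ≤ l) :
    IntegrableOn (fun t : ℝ => t ^ (-1 - α) * (1 - Real.exp (-(t * l)))) (Ioi 0) := by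
  have hcont : ContinuousOn (fun t : ℝ => t ^ (-1 - α) * (1 - Real.exp (-(t * l)))) (Ioi 0) :=
    (continuousOn_id.rpow_const fun t ht => Or.inl (ne_of_gt ht)).mul
      (continuous_const.sub (Real.continuous_exp.comp
        ((continuous_id.mul continuous_const).neg))).continuousOn
  have hle : ∀ y : ℝ, 1 - Real.exp (-y) ≤ y := fun y => by linarith [Real.add_one_le_exp (-y)]
  have hle1 : ∀ y : ℝ, 1 - Real.exp (-y) ≤ 1 := fun y => by linarith [Real.exp_nonneg (-y)]
  rw [← Ioc_union_Ioi_eq_Ioi zero_le_one]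
  refine IntegrableOn.union ?_ ?_
  · -- on `(0, 1]`: bound by `l t^{-α}`
    have hmaj : IntegrableOn (fun t : ℝ => l * t ^ (-α)) (Ioc 0 1) :=
      ((intervalIntegrable_iff_integrableOn_Ioc_of_le zero_le_one).1
        (intervalIntegral.intervalIntegrable_rpow' (by linarith : -1 < -α))).const_mul l
    refine Integrable.mono' hmaj
      ((hcont.mono Ioc_subset_Ioi_self).aestronglyMeasurable measurableSet_Ioc) ?_
    filter_upwards [ae_restrict_mem measurableSet_Ioc] with t ht
    rw [Real.norm_of_nonneg (momentWeight_nonneg α hl ht.1.le)]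
    calc t ^ (-1 - α) * (1 - Real.exp (-(t * l)))
        ≤ t ^ (-1 - α) * (t * l) :=
          mul_le_mul_of_nonneg_left (hle _) (Real.rpow_nonneg ht.1.le _)
      _ = l * t ^ (-α) := by
          have h : t ^ (-α) = t ^ (-1 - α) * t := by
            rw [← Real.rpow_add_one (ne_of_gt ht.1)]; ring_nf
          rw [h]; ring
  · -- on `(1, ∞)`: bound by `t^{-1-α}`
    refine Integrable.mono' (integrableOn_Ioi_rpow_of_lt (by linarith : -1 - α < -1) one_pos)
      ((hcont.mono (Ioi_subset_Ioi zero_le_one)).aestronglyMeasurable measurableSet_Ioi) ?_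
    filter_upwards [ae_restrict_mem measurableSet_Ioi] with t ht
    have ht0 : 0 ≤ t := zero_le_one.trans (le_of_lt ht)
    rw [Real.norm_of_nonneg (momentWeight_nonneg α hl ht0)]
    calc t ^ (-1 - α) * (1 - Real.exp (-(t * l))) ≤ t ^ (-1 - α) * 1 :=
          mul_le_mul_of_nonneg_left (hle1 _) (Real.rpow_nonneg ht0 _)
      _ = t ^ (-1 - α) := mul_one _

/-- **Scaling of the weight integral**: for `0 < α` and `λ ≥ 0`,
`∫₀^∞ t^{-1-α}(1 - e^{-tλ}) dt = λ^α ∫₀^∞ t^{-1-α}(1 - e^{-t}) dt` (substitution `t ↦ λt`; both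
sides vanish for `λ = 0`). This is the scalar form of the Balakrishnan-type representation of
`A^α` through the semigroup (cf. Pazy 1983, §2.6 (6.9) for `A^{-α}`). [folklore] -/
theorem integral_momentWeight_eq (hα0 : 0 < α) {l : ℝ} (hl : 0 ≤ l) :
    ∫ t in Ioi 0, t ^ (-1 - α) * (1 - Real.exp (-(t * l))) =
      l ^ α * ∫ t in Ioi 0, t ^ (-1 - α) * (1 - Real.exp (-t)) := by
  rcases hl.eq_or_lt with hl0 | hl0
  · subst hl0
    simp [Real.zero_rpow (ne_of_gt hα0)]
  · set g : ℝ → ℝ := fun t => t ^ (-1 - α) * (1 - Real.exp (-t)) with hg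
    have hpt : ∀ t ∈ Ioi (0 : ℝ), t ^ (-1 - α) * (1 - Real.exp (-(t * l))) =
        l ^ (1 + α) * g (l * t) := by
      intro t ht
      rw [hg]
      dsimp only
      rw [Real.mul_rpow hl (le_of_lt ht), mul_comm t l]
      have h1 : l ^ (1 + α) * l ^ (-1 - α) = 1 := by
        rw [← Real.rpow_add hl0]; norm_num
      calc t ^ (-1 - α) * (1 - Real.exp (-(l * t)))
          = (l ^ (1 + α) * l ^ (-1 - α)) * (t ^ (-1 - α) * (1 - Real.exp (-(l * t)))) := by
            rw [h1, one_mul]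
        _ = l ^ (1 + α) * (l ^ (-1 - α) * t ^ (-1 - α) * (1 - Real.exp (-(l * t)))) := by ring
    rw [setIntegral_congr_fun measurableSet_Ioi hpt, integral_const_mul,
      integral_comp_mul_left_Ioi g 0 hl0, mul_zero, smul_eq_mul, ← mul_assoc]
    congr 1
    rw [Real.rpow_add hl0, Real.rpow_one, mul_comm, ← mul_assoc, inv_mul_cancel₀ (ne_of_gt hl0),
      one_mul]

/-- **The moment constant is positive**: `0 < I_α = ∫₀^∞ t^{-1-α}(1 - e^{-t}) dt` (the integrand is
positive on `(0, ∞)`, a set of infinite measure). [folklore] -/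
theorem momentConst_pos (hα0 : 0 < α) (hα1 : α < 1) :
    0 < ∫ t in Ioi 0, t ^ (-1 - α) * (1 - Real.exp (-t)) := by
  have hint : IntegrableOn (fun t : ℝ => t ^ (-1 - α) * (1 - Real.exp (-t))) (Ioi 0) := by
    simpa using integrableOn_momentWeight hα0 hα1 zero_le_one
  rw [setIntegral_pos_iff_support_of_nonneg_ae ?_ hint]
  · have hsub : Ioi (0 : ℝ) ⊆
        support (fun t : ℝ => t ^ (-1 - α) * (1 - Real.exp (-t))) ∩ Ioi 0 := by
      intro t ht
      refine ⟨?_, ht⟩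
      rw [mem_support]
      refine (mul_pos (Real.rpow_pos_of_pos ht _) ?_).ne'
      rw [sub_pos, Real.exp_lt_one_iff]
      exact neg_lt_zero.2 ht
    refine lt_of_lt_of_le ?_ (measure_mono hsub)
    simp [Real.volume_Ioi]
  · filter_upwards [ae_restrict_mem measurableSet_Ioi] with t ht
    simpa using momentWeight_nonneg α zero_le_one (le_of_lt ht)

end Scalar

/-! ## The heat-semigroup representation of `(-Δ)^α` -/

section Representation

variable {d : Type*} [Fintype d] [DecidableEq d] {α : ℝ}

/-- The modes of the representation integrand: for `s > 0`,
`s^{-1-α} • (u(x) - e^{sΔ}u(x)) = ∑ₖ Re((s^{-1-α}(1 - e^{-sλ_k})) e_k(x) û(k))`, `λ_k = 4π²|k|²`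
(from `Torus.hasSum_sub_heatSmoothing`). [folklore] -/
theorem hasSum_rpow_smul_sub_heatSmoothing {u : UnitAddTorus d → EuclideanSpace ℝ d}
    (hu : IsSmooth u) (α : ℝ) {s : ℝ} (hs : 0 < s) (x : UnitAddTorus d) :
    HasSum (fun k : d → ℤ => EuclideanSpace.realPart
        ((s ^ (-1 - α) * (1 - Real.exp (-(s * (4 * Real.pi ^ 2 * freqNormSq k))))) •
          (mFourier k x • mFourierCoeff (EuclideanSpace.complexify ∘ u) k)))
      (s ^ (-1 - α) • (u x - ∫ z : EuclideanSpace ℝ d, heatKernel s z • u (x - proj z))) := by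
  refine ((hasSum_sub_heatSmoothing hu hs x).const_smul (s ^ (-1 - α))).congr_fun fun k => ?_
  rw [← map_smul, smul_smul]

omit [DecidableEq d] in
/-- Each mode is bounded by its weighted coefficient:
`‖Re((s^{-1-α}(1 - e^{-sλ_k})) e_k(x) c)‖ ≤ s^{-1-α}(1 - e^{-sλ_k}) ‖c‖` (`s > 0`). [folklore] -/
theorem norm_realPart_momentMode_le (α : ℝ) {s : ℝ} (hs : 0 < s) (k : d → ℤ) (x : UnitAddTorus d)
    (c : EuclideanSpace ℂ d) :
    ‖EuclideanSpace.realPart ((s ^ (-1 - α) * (1 - Real.exp (-(s * (4 * Real.pi ^ 2 * freqNormSq k))))) •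
        (mFourier k x • c))‖ ≤
      s ^ (-1 - α) * (1 - Real.exp (-(s * (4 * Real.pi ^ 2 * freqNormSq k)))) * ‖c‖ := by
  have hw : 0 ≤ s ^ (-1 - α) * (1 - Real.exp (-(s * (4 * Real.pi ^ 2 * freqNormSq k)))) :=
    momentWeight_nonneg α (by have := freqNormSq_nonneg k; positivity) hs.le
  rw [map_smul, norm_smul, Real.norm_of_nonneg hw]
  exact mul_le_mul_of_nonneg_left (norm_realPart_mFourier_smul_le k x c) hw

omit [DecidableEq d] in
/-- The time integral of (the norm of) each mode:
`∫₀^∞ ‖Re((s^{-1-α}(1 - e^{-sλ_k})) e_k(x) c)‖ ds ≤ λ_k^α I_α ‖c‖`. [folklore] -/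
theorem lintegral_enorm_momentMode_le (hα0 : 0 < α) (hα1 : α < 1) (k : d → ℤ)
    (x : UnitAddTorus d) (c : EuclideanSpace ℂ d) :
    ∫⁻ s in Ioi 0, ‖EuclideanSpace.realPart
        ((s ^ (-1 - α) * (1 - Real.exp (-(s * (4 * Real.pi ^ 2 * freqNormSq k))))) •
          (mFourier k x • c))‖ₑ ≤
      ENNReal.ofReal (fracSymbol α k * (∫ t in Ioi 0, t ^ (-1 - α) * (1 - Real.exp (-t))) * ‖c‖) := by
  have hl : 0 ≤ 4 * Real.pi ^ 2 * freqNormSq k := by have := freqNormSq_nonneg k; positivity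
  have hgi : Integrable (fun s : ℝ =>
      s ^ (-1 - α) * (1 - Real.exp (-(s * (4 * Real.pi ^ 2 * freqNormSq k)))) * ‖c‖)
      (volume.restrict (Ioi 0)) :=
    (integrableOn_momentWeight hα0 hα1 hl).mul_const _
  calc ∫⁻ s in Ioi 0, ‖EuclideanSpace.realPart
        ((s ^ (-1 - α) * (1 - Real.exp (-(s * (4 * Real.pi ^ 2 * freqNormSq k))))) •
          (mFourier k x • c))‖ₑ
      ≤ ∫⁻ s in Ioi 0, ENNReal.ofReal
          (s ^ (-1 - α) * (1 - Real.exp (-(s * (4 * Real.pi ^ 2 * freqNormSq k)))) * ‖c‖) := by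
        refine setLIntegral_mono' measurableSet_Ioi fun s hs => ?_
        rw [← ofReal_norm]
        exact ENNReal.ofReal_le_ofReal (norm_realPart_momentMode_le α hs k x c)
    _ = ENNReal.ofReal (∫ s in Ioi 0,
          s ^ (-1 - α) * (1 - Real.exp (-(s * (4 * Real.pi ^ 2 * freqNormSq k)))) * ‖c‖) := by
        rw [ofReal_integral_eq_lintegral_ofReal hgi]
        filter_upwards [ae_restrict_mem measurableSet_Ioi] with s hs
        exact mul_nonneg (momentWeight_nonneg α hl (le_of_lt hs)) (norm_nonneg _)
    _ = ENNReal.ofReal (fracSymbol α k * (∫ t in Ioi 0, t ^ (-1 - α) * (1 - Real.exp (-t))) * ‖c‖) := by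
        rw [integral_mul_const, integral_momentWeight_eq hα0 hl, fracSymbol]

/-- The integrand `s ↦ u(x) - e^{sΔ}u(x)` is continuous on `(0, ∞)` for smooth `u`. [folklore] -/
theorem continuousOn_sub_heatSmoothing {u : UnitAddTorus d → EuclideanSpace ℝ d} (hu : IsSmooth u)
    (x : UnitAddTorus d) :
    ContinuousOn (fun s : ℝ => u x - ∫ z : EuclideanSpace ℝ d, heatKernel s z • u (x - proj z))
      (Ioi 0) :=
  continuousOn_const.sub ((continuousOn_heatSmoothing hu).comp
    (continuousOn_const.prodMk continuousOn_id) fun _ hs => ⟨mem_univ _, hs⟩)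

/-- **Heat-semigroup representation of the fractional Laplacian.** For `0 < α < 1`, a smooth
real vector field `u` on `T^d` and `x ∈ T^d`, the function `s ↦ s^{-1-α}(u(x) - e^{sΔ}u(x))` is
integrable on `(0, ∞)` and

  `∫₀^∞ s^{-1-α} (u(x) - e^{sΔ}u(x)) ds = I_α · ((-Δ)^α u)(x)`,  `I_α = ∫₀^∞ t^{-1-α}(1 - e^{-t}) dt`,

where `e^{sΔ}u(x) = ∫ G_s(z) u(x - proj z) dz`: termwise time integration of
`∑ₖ Re((s^{-1-α}(1 - e^{-sλ_k})) e_k(x) û(k))` with `∫₀^∞ s^{-1-α}(1 - e^{-sλ}) ds = λ^α I_α`,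
against the defining series `(-Δ)^α u(x) = ∑ₖ Re(λ_k^α e_k(x) û(k))` (`Torus.hasSum_fracLaplacian`).
This is the semigroup form of Pazy's representation of fractional powers (Pazy 1983, §2.6,
(6.9) and Thm. 6.9). [folklore] -/
theorem integral_rpow_smul_sub_heatSmoothing (hα0 : 0 < α) (hα1 : α < 1)
    {u : UnitAddTorus d → EuclideanSpace ℝ d} (hu : IsSmooth u) (x : UnitAddTorus d) :
    IntegrableOn (fun s : ℝ => s ^ (-1 - α) •
        (u x - ∫ z : EuclideanSpace ℝ d, heatKernel s z • u (x - proj z))) (Ioi 0) ∧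
      ∫ s in Ioi 0, s ^ (-1 - α) •
          (u x - ∫ z : EuclideanSpace ℝ d, heatKernel s z • u (x - proj z)) =
        (∫ t in Ioi 0, t ^ (-1 - α) * (1 - Real.exp (-t))) • fracLaplacian α u x := by
  set c : (d → ℤ) → EuclideanSpace ℂ d := mFourierCoeff (EuclideanSpace.complexify ∘ u) with hc
  set I : ℝ := ∫ t in Ioi 0, t ^ (-1 - α) * (1 - Real.exp (-t)) with hI
  have hI0 : 0 < I := momentConst_pos hα0 hα1
  have hl : ∀ k : d → ℤ, 0 ≤ 4 * Real.pi ^ 2 * freqNormSq k := fun k => by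
    have := freqNormSq_nonneg k; positivity
  set g : (d → ℤ) → ℝ → EuclideanSpace ℝ d := fun k s => EuclideanSpace.realPart
    ((s ^ (-1 - α) * (1 - Real.exp (-(s * (4 * Real.pi ^ 2 * freqNormSq k))))) •
      (mFourier k x • c k)) with hg
  set F : ℝ → EuclideanSpace ℝ d := fun s => s ^ (-1 - α) •
    (u x - ∫ z : EuclideanSpace ℝ d, heatKernel s z • u (x - proj z)) with hF
  -- (1) `F = ∑ₖ g k` on `(0, ∞)`, with summable norms
  have hFg : ∀ s ∈ Ioi (0 : ℝ), F s = ∑' k, g k s := fun s hs =>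
    ((hasSum_rpow_smul_sub_heatSmoothing hu α hs x).tsum_eq).symm
  have hsumg : ∀ s ∈ Ioi (0 : ℝ), Summable fun k => ‖g k s‖ := by
    intro s hs
    refine Summable.of_nonneg_of_le (fun k => norm_nonneg _)
      (fun k => norm_realPart_momentMode_le α hs k x (c k)) ?_
    refine Summable.of_nonneg_of_le
      (fun k => mul_nonneg (momentWeight_nonneg α (hl k) (le_of_lt hs)) (norm_nonneg _))
      (fun k => ?_) ((summable_norm_mFourierCoeff_of_isSmooth hu).mul_left (s ^ (-1 - α)))
    exact mul_le_mul_of_nonneg_right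
      (mul_le_of_le_one_right (Real.rpow_nonneg (le_of_lt hs) _)
        (by linarith [Real.exp_nonneg (-(s * (4 * Real.pi ^ 2 * freqNormSq k)))]))
      (norm_nonneg _)
  -- (2) measurability
  have hgm : ∀ k, AEStronglyMeasurable (g k) (volume.restrict (Ioi 0)) := by
    intro k
    refine ContinuousOn.aestronglyMeasurable ?_ measurableSet_Ioi
    exact EuclideanSpace.realPart.continuous.comp_continuousOn
      (((continuousOn_id.rpow_const fun t ht => Or.inl (ne_of_gt ht)).mul
        (continuous_const.sub (Real.continuous_exp.comp
          ((continuous_id.mul continuous_const).neg))).continuousOn).smul continuousOn_const)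
  have hFm : AEStronglyMeasurable F (volume.restrict (Ioi 0)) :=
    ((continuousOn_id.rpow_const fun t ht => Or.inl (ne_of_gt ht)).smul
      (continuousOn_sub_heatSmoothing hu x)).aestronglyMeasurable measurableSet_Ioi
  -- (3) summable time integrals of the modes
  have hlint : ∀ k, ∫⁻ s in Ioi 0, ‖g k s‖ₑ ≤ ENNReal.ofReal (fracSymbol α k * I * ‖c k‖) :=
    fun k => lintegral_enorm_momentMode_le hα0 hα1 k x (c k)
  have hS : Summable fun k => fracSymbol α k * I * ‖c k‖ :=
    ((summable_fracSymbol_mul_norm hα0.le hu).mul_left I).congr fun k => by ring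
  have htsum : ∑' k, ∫⁻ s in Ioi 0, ‖g k s‖ₑ ≠ ⊤ := by
    refine ne_top_of_le_ne_top (ENNReal.ofReal_ne_top (r := ∑' k, fracSymbol α k * I * ‖c k‖)) ?_
    rw [ENNReal.ofReal_tsum_of_nonneg
      (fun k => mul_nonneg (mul_nonneg (fracSymbol_nonneg α k) hI0.le) (norm_nonneg _)) hS]
    exact ENNReal.tsum_le_tsum hlint
  -- (4) integrability of `F`
  have hFint : IntegrableOn F (Ioi 0) := by
    refine ⟨hFm, ?_⟩
    calc ∫⁻ s in Ioi 0, ‖F s‖ₑ ≤ ∫⁻ s in Ioi 0, ∑' k, ‖g k s‖ₑ := by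
          refine setLIntegral_mono' measurableSet_Ioi fun s hs => ?_
          rw [hFg s hs, ← ofReal_norm]
          calc ENNReal.ofReal ‖∑' k, g k s‖ ≤ ENNReal.ofReal (∑' k, ‖g k s‖) :=
                ENNReal.ofReal_le_ofReal (norm_tsum_le_tsum_norm (hsumg s hs))
            _ = ∑' k, ‖g k s‖ₑ := by
                rw [ENNReal.ofReal_tsum_of_nonneg (fun k => norm_nonneg _) (hsumg s hs)]
                simp_rw [ofReal_norm]
      _ = ∑' k, ∫⁻ s in Ioi 0, ‖g k s‖ₑ := lintegral_tsum fun k => (hgm k).enorm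
      _ < ⊤ := lt_top_iff_ne_top.2 htsum
  refine ⟨hFint, ?_⟩
  -- (5) termwise time integrals
  have hterm : ∀ k, ∫ s in Ioi 0, g k s =
      I • EuclideanSpace.realPart (fracSymbol α k • (mFourier k x • c k)) := by
    intro k
    rw [hg]
    dsimp only
    rw [ContinuousLinearMap.integral_comp_comm _ ((integrableOn_momentWeight hα0 hα1 (hl k)).smul_const _),
      integral_smul_const, integral_momentWeight_eq hα0 (hl k), ← map_smul, smul_smul,
      mul_comm I (fracSymbol α k), fracSymbol]
  rw [setIntegral_congr_fun measurableSet_Ioi hFg, integral_tsum hgm htsum]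
  simp_rw [hterm]
  exact ((hasSum_fracLaplacian hα0.le hu x).const_smul I).tsum_eq

/-- **Pazy's (6.18) for `A = -Δ` on `L^p(T^d)`.** For `0 < α < 1`, `1 ≤ p < ∞`, a smooth real
vector field `u` on `T^d` and every `ρ > 0`,

  `‖(-Δ)^α u‖_{L^p} ≤ I_α⁻¹ (ρ^{1-α}/(1-α) ‖Δu‖_{L^p} + (ρ^{-α}/α) · 2‖u‖_{L^p})`

(the representation `(-Δ)^α u = I_α⁻¹∫₀^∞ s^{-1-α}(u - e^{sΔ}u) ds` split at `s = ρ`, Minkowski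
in `s`, `‖u - e^{sΔ}u‖_p ≤ s‖Δu‖_p` on `(0, ρ]` and `‖u - e^{sΔ}u‖_p ≤ 2‖u‖_p` on `(ρ, ∞)`;
Pazy's `C₀(ρ^α‖x‖ + ρ^{α-1}‖Ax‖)` with `ρ ↔ ρ⁻¹`). [cite: Pazy1983, §2.6 Thm. 6.10 (6.18)] -/
theorem eLpNorm_fracLaplacian_le_of_pos (hα0 : 0 < α) (hα1 : α < 1) {p : ℝ≥0∞} (hp : 1 ≤ p)
    (hp' : p ≠ ⊤) {u : UnitAddTorus d → EuclideanSpace ℝ d} (hu : IsSmooth u) {ρ : ℝ}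
    (hρ : 0 < ρ) :
    eLpNorm (fracLaplacian α u) p volume ≤
      ENNReal.ofReal (∫ t in Ioi 0, t ^ (-1 - α) * (1 - Real.exp (-t)))⁻¹ *
        (ENNReal.ofReal (ρ ^ (1 - α) / (1 - α)) * eLpNorm (laplacian u) p volume +
          ENNReal.ofReal (ρ ^ (-α) / α) * (2 * eLpNorm u p volume)) := by
  set I : ℝ := ∫ t in Ioi 0, t ^ (-1 - α) * (1 - Real.exp (-t)) with hI
  have hI0 : 0 < I := momentConst_pos hα0 hα1
  -- the smoothing error and the two pieces of the representation
  set D : ℝ → UnitAddTorus d → EuclideanSpace ℝ d := fun s x =>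
    u x - ∫ z : EuclideanSpace ℝ d, heatKernel s z • u (x - proj z) with hD
  set Φ₁ : UnitAddTorus d → ℝ → EuclideanSpace ℝ d := fun x r => r⁻¹ • D r x with hΦ₁
  set F₁ : UnitAddTorus d → EuclideanSpace ℝ d := fun x =>
    ∫ r in Ioc 0 ρ, (r ^ (-α)) • Φ₁ x r with hF₁
  set F₂ : UnitAddTorus d → EuclideanSpace ℝ d := fun x =>
    ∫ r in Ioi ρ, (r ^ (-1 - α)) • D r x with hF₂
  -- (a) pointwise: `(-Δ)^α u (x) = I⁻¹ • (F₁ x + F₂ x)`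
  have hrep : ∀ x, fracLaplacian α u x = I⁻¹ • (F₁ x + F₂ x) := by
    intro x
    obtain ⟨hint, heq⟩ := integral_rpow_smul_sub_heatSmoothing hα0 hα1 hu x
    have hsplit : ∫ s in Ioi 0, s ^ (-1 - α) • D s x = F₁ x + F₂ x := by
      rw [← Ioc_union_Ioi_eq_Ioi hρ.le, setIntegral_union (Ioc_disjoint_Ioi le_rfl)
        measurableSet_Ioi (hint.mono_set Ioc_subset_Ioi_self)
        (hint.mono_set (Ioi_subset_Ioi hρ.le))]
      congr 1
      refine setIntegral_congr_fun measurableSet_Ioc fun r hr => ?_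
      rw [hΦ₁]
      dsimp only
      rw [smul_smul, show (-1 - α : ℝ) = -α + -1 by ring, Real.rpow_add hr.1, Real.rpow_neg_one]
    rw [← hsplit, heq, smul_smul, inv_mul_cancel₀ (ne_of_gt hI0), one_smul]
  -- (b) joint continuity and measurability
  have hDcont : ContinuousOn (fun q : UnitAddTorus d × ℝ => D q.2 q.1) (univ ×ˢ Ioi 0) :=
    ((hu.continuous.comp continuous_fst).continuousOn).sub (continuousOn_heatSmoothing hu)
  have hprod : ∀ (S : Set ℝ), MeasurableSet S → S ⊆ Ioi 0 →
      ∀ {G : UnitAddTorus d × ℝ → EuclideanSpace ℝ d}, ContinuousOn G (univ ×ˢ Ioi 0) →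
        AEStronglyMeasurable G ((volume : Measure (UnitAddTorus d)).prod (volume.restrict S)) := by
    intro S hS hsub G hG
    have hμ : (volume : Measure (UnitAddTorus d)).prod (volume.restrict S) =
        ((volume : Measure (UnitAddTorus d)).prod volume).restrict (univ ×ˢ S) := by
      rw [← Measure.prod_restrict, Measure.restrict_univ]
    rw [hμ]
    exact (hG.mono (prod_mono le_rfl hsub)).aestronglyMeasurable (MeasurableSet.univ.prod hS)
  have hΦ₁cont : ContinuousOn (fun q : UnitAddTorus d × ℝ => Φ₁ q.1 q.2) (univ ×ˢ Ioi 0) :=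
    (continuousOn_snd.inv₀ fun q hq => ne_of_gt hq.2).smul hDcont
  have hΨ₁cont : ContinuousOn (fun q : UnitAddTorus d × ℝ => (q.2 ^ (-α)) • Φ₁ q.1 q.2)
      (univ ×ˢ Ioi 0) :=
    (continuousOn_snd.rpow_const fun q hq => Or.inl (ne_of_gt hq.2)).smul hΦ₁cont
  have hΨ₂cont : ContinuousOn (fun q : UnitAddTorus d × ℝ => (q.2 ^ (-1 - α)) • D q.2 q.1)
      (univ ×ˢ Ioi 0) :=
    (continuousOn_snd.rpow_const fun q hq => Or.inl (ne_of_gt hq.2)).smul hDcont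
  have hF₁m : AEStronglyMeasurable F₁ volume :=
    (hprod (Ioc 0 ρ) measurableSet_Ioc Ioc_subset_Ioi_self hΨ₁cont).integral_prod_right'
  have hF₂m : AEStronglyMeasurable F₂ volume :=
    (hprod (Ioi ρ) measurableSet_Ioi (Ioi_subset_Ioi hρ.le) hΨ₂cont).integral_prod_right'
  -- (c) Minkowski in time on `(0, ρ]`
  have hB₁ : eLpNorm F₁ p volume ≤
      ENNReal.ofReal (ρ ^ (1 - α) / (1 - α)) * eLpNorm (laplacian u) p volume := by
    have hk : AEStronglyMeasurable (fun r : ℝ => r ^ (-α)) (volume.restrict (Ioc 0 ρ)) :=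
      ((continuousOn_id.rpow_const fun t ht => Or.inl (ne_of_gt ht.1)).aestronglyMeasurable
        measurableSet_Ioc)
    have hΦm : AEStronglyMeasurable (uncurry Φ₁)
        ((volume : Measure (UnitAddTorus d)).prod (volume.restrict (Ioc 0 ρ))) :=
      hprod (Ioc 0 ρ) measurableSet_Ioc Ioc_subset_Ioi_self hΦ₁cont
    have hA : ∀ᵐ r ∂(volume.restrict (Ioc 0 ρ)), r ^ (-α) ≠ 0 →
        eLpNorm (fun x => Φ₁ x r) p volume ≤ eLpNorm (laplacian u) p volume := by
      filter_upwards [ae_restrict_mem measurableSet_Ioc] with r hr _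
      have hr0 : 0 < r := hr.1
      have h1 : (fun x => Φ₁ x r) = r⁻¹ • fun x => D r x := rfl
      rw [h1, eLpNorm_const_smul]
      calc ‖r⁻¹‖ₑ * eLpNorm (fun x => D r x) p volume
          ≤ ‖r⁻¹‖ₑ * (ENNReal.ofReal r * eLpNorm (laplacian u) p volume) :=
            mul_le_mul_right (eLpNorm_sub_heatSmoothing_le hu hr0 hp hp') _
        _ = eLpNorm (laplacian u) p volume := by
            rw [← mul_assoc, Real.enorm_eq_ofReal (inv_nonneg.2 hr0.le),
              ← ENNReal.ofReal_mul (inv_nonneg.2 hr0.le), inv_mul_cancel₀ (ne_of_gt hr0),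
              ENNReal.ofReal_one, one_mul]
    calc eLpNorm F₁ p volume
        ≤ (∫⁻ r in Ioc 0 ρ, ‖r ^ (-α)‖ₑ) * eLpNorm (laplacian u) p volume :=
          eLpNorm_integral_smul_le_mul hk hΦm hp hp' hA
      _ = ENNReal.ofReal (ρ ^ (1 - α) / (1 - α)) * eLpNorm (laplacian u) p volume := by
          congr 1
          have hi : IntegrableOn (fun r : ℝ => r ^ (-α)) (Ioc 0 ρ) :=
            (intervalIntegrable_iff_integrableOn_Ioc_of_le hρ.le).1
              (intervalIntegral.intervalIntegrable_rpow' (by linarith))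
          rw [setLIntegral_congr_fun measurableSet_Ioc
              (fun r hr => Real.enorm_eq_ofReal (Real.rpow_nonneg hr.1.le _)),
            ← ofReal_integral_eq_lintegral_ofReal hi, ← intervalIntegral.integral_of_le hρ.le,
            integral_rpow (Or.inl (by linarith)), Real.zero_rpow (by linarith), sub_zero]
          · congr 1
            rw [show (-α + 1 : ℝ) = 1 - α by ring]
          · filter_upwards [ae_restrict_mem measurableSet_Ioc] with r hr
            exact Real.rpow_nonneg hr.1.le _
  -- (c') Minkowski in time on `(ρ, ∞)`
  have hB₂ : eLpNorm F₂ p volume ≤ ENNReal.ofReal (ρ ^ (-α) / α) * (2 * eLpNorm u p volume) := by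
    have hk : AEStronglyMeasurable (fun r : ℝ => r ^ (-1 - α)) (volume.restrict (Ioi ρ)) :=
      ((continuousOn_id.rpow_const fun t ht => Or.inl (ne_of_gt (hρ.trans ht))).aestronglyMeasurable
        measurableSet_Ioi)
    have hDm : AEStronglyMeasurable (uncurry fun x r => D r x)
        ((volume : Measure (UnitAddTorus d)).prod (volume.restrict (Ioi ρ))) :=
      hprod (Ioi ρ) measurableSet_Ioi (Ioi_subset_Ioi hρ.le) hDcont
    have hA : ∀ᵐ r ∂(volume.restrict (Ioi ρ)), r ^ (-1 - α) ≠ 0 →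
        eLpNorm (fun x => D r x) p volume ≤ 2 * eLpNorm u p volume := by
      filter_upwards [ae_restrict_mem measurableSet_Ioi] with r hr _
      have hr0 : 0 < r := hρ.trans hr
      calc eLpNorm (fun x => D r x) p volume
          ≤ eLpNorm u p volume + eLpNorm (fun x =>
              ∫ z : EuclideanSpace ℝ d, heatKernel r z • u (x - proj z)) p volume :=
            eLpNorm_sub_le hu.continuous.aestronglyMeasurable
              (continuous_heatSmoothing hu hr0).aestronglyMeasurable hp
        _ ≤ eLpNorm u p volume + eLpNorm u p volume :=
            add_le_add le_rfl (eLpNorm_heatSmoothing_le hu.continuous hr0 hp hp')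
        _ = 2 * eLpNorm u p volume := (two_mul _).symm
    calc eLpNorm F₂ p volume
        ≤ (∫⁻ r in Ioi ρ, ‖r ^ (-1 - α)‖ₑ) * (2 * eLpNorm u p volume) :=
          eLpNorm_integral_smul_le_mul hk hDm hp hp' hA
      _ = ENNReal.ofReal (ρ ^ (-α) / α) * (2 * eLpNorm u p volume) := by
          congr 1
          have hi : IntegrableOn (fun r : ℝ => r ^ (-1 - α)) (Ioi ρ) :=
            integrableOn_Ioi_rpow_of_lt (by linarith) hρ
          rw [setLIntegral_congr_fun measurableSet_Ioi
              (fun r hr => Real.enorm_eq_ofReal (Real.rpow_nonneg (hρ.trans hr).le _)),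
            ← ofReal_integral_eq_lintegral_ofReal hi, integral_Ioi_rpow_of_lt (by linarith) hρ]
          · congr 1
            rw [show (-1 - α + 1 : ℝ) = -α by ring, neg_div, div_neg, neg_neg]
          · filter_upwards [ae_restrict_mem measurableSet_Ioi] with r hr
            exact Real.rpow_nonneg (hρ.trans hr).le _
  -- (d) assemble
  have hfun : fracLaplacian α u = I⁻¹ • (F₁ + F₂) := by
    funext x
    rw [hrep x]
    rfl
  rw [hfun, eLpNorm_const_smul, Real.enorm_eq_ofReal (inv_nonneg.2 hI0.le)]
  exact mul_le_mul_right ((eLpNorm_add_le hF₁m hF₂m hp).trans (add_le_add hB₁ hB₂)) _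

end Representation

/-! ## Optimisation in `ρ` and the discharge -/

section Discharge

/-- **Optimisation of Pazy's (6.18) in `ρ`** (in `ℝ≥0∞`): if
`L ≤ K (ρ^{1-α}/(1-α) · b + (ρ^{-α}/α) · 2a)` for every `ρ > 0`, with `a, b < ∞` and
`0 < α < 1`, then `L ≤ K(1/(1-α) + 2/α) a^{1-α} b^α` (for `a, b ≠ 0` take `ρ = a/b`; if `b = 0`
let `ρ → ∞`, if `a = 0` let `ρ → 0⁺`; Pazy 1983, end of the proof of Thm. 6.10). [folklore] -/
theorem le_rpow_mul_rpow_of_forall_pos {α : ℝ} (hα0 : 0 < α) (hα1 : α < 1) {K : ℝ} (hK : 0 ≤ K)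
    {a b L : ℝ≥0∞} (ha : a ≠ ⊤) (hb : b ≠ ⊤)
    (h : ∀ ρ : ℝ, 0 < ρ → L ≤ ENNReal.ofReal K *
      (ENNReal.ofReal (ρ ^ (1 - α) / (1 - α)) * b + ENNReal.ofReal (ρ ^ (-α) / α) * (2 * a))) :
    L ≤ ENNReal.ofReal (K * (1 / (1 - α) + 2 / α)) * a ^ (1 - α) * b ^ α := by
  have h1α : 0 < 1 - α := by linarith
  rcases eq_or_ne b 0 with hb0 | hb0
  · -- `b = 0`: let `ρ → ∞`
    subst hb0
    have h1 : Tendsto (fun ρ : ℝ => ρ ^ (-α) / α) atTop (𝓝 0) := by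
      simpa using (tendsto_rpow_neg_atTop hα0).div_const α
    have h2 : Tendsto (fun ρ : ℝ => ENNReal.ofReal (ρ ^ (-α) / α) * (2 * a)) atTop (𝓝 0) := by
      have := ENNReal.Tendsto.mul_const (ENNReal.tendsto_ofReal h1)
        (Or.inr (ENNReal.mul_ne_top ENNReal.ofNat_ne_top ha) : (ENNReal.ofReal 0 ≠ 0) ∨ 2 * a ≠ ⊤)
      simpa using this
    have h3 : Tendsto (fun ρ : ℝ => ENNReal.ofReal K *
        (ENNReal.ofReal (ρ ^ (1 - α) / (1 - α)) * 0 + ENNReal.ofReal (ρ ^ (-α) / α) * (2 * a)))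
        atTop (𝓝 0) := by
      have := ENNReal.Tendsto.const_mul h2 (Or.inr ENNReal.ofReal_ne_top :
        (0 : ℝ≥0∞) ≠ 0 ∨ ENNReal.ofReal K ≠ ⊤)
      simpa using this
    have hL : L ≤ 0 := ge_of_tendsto h3 ((eventually_gt_atTop 0).mono fun ρ hρ => h ρ hρ)
    exact hL.trans zero_le
  rcases eq_or_ne a 0 with ha0 | ha0
  · -- `a = 0`: let `ρ → 0⁺`
    subst ha0
    have h1 : Tendsto (fun ρ : ℝ => ρ ^ (1 - α) / (1 - α)) (𝓝[>] 0) (𝓝 0) := by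
      have hc := ((Real.continuousAt_rpow_const 0 (1 - α) (Or.inr h1α.le)).tendsto).div_const (1 - α)
      rw [Real.zero_rpow (ne_of_gt h1α), zero_div] at hc
      exact tendsto_nhdsWithin_of_tendsto_nhds hc
    have h2 : Tendsto (fun ρ : ℝ => ENNReal.ofReal (ρ ^ (1 - α) / (1 - α)) * b) (𝓝[>] 0) (𝓝 0) := by
      have := ENNReal.Tendsto.mul_const (ENNReal.tendsto_ofReal h1)
        (Or.inr hb : (ENNReal.ofReal 0 ≠ 0) ∨ b ≠ ⊤)
      simpa using this
    have h3 : Tendsto (fun ρ : ℝ => ENNReal.ofReal K *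
        (ENNReal.ofReal (ρ ^ (1 - α) / (1 - α)) * b + ENNReal.ofReal (ρ ^ (-α) / α) * (2 * 0)))
        (𝓝[>] 0) (𝓝 0) := by
      have := ENNReal.Tendsto.const_mul h2 (Or.inr ENNReal.ofReal_ne_top :
        (0 : ℝ≥0∞) ≠ 0 ∨ ENNReal.ofReal K ≠ ⊤)
      simpa using this
    have hL : L ≤ 0 := ge_of_tendsto h3 (eventually_nhdsWithin_of_forall fun ρ hρ => h ρ hρ)
    exact hL.trans zero_le
  -- `a, b ∈ (0, ∞)`: take `ρ = a/b`
  set A : ℝ := a.toReal with hA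
  set B : ℝ := b.toReal with hB
  have hA0 : 0 < A := ENNReal.toReal_pos ha0 ha
  have hB0 : 0 < B := ENNReal.toReal_pos hb0 hb
  have haA : a = ENNReal.ofReal A := (ENNReal.ofReal_toReal ha).symm
  have hbB : b = ENNReal.ofReal B := (ENNReal.ofReal_toReal hb).symm
  have hρ : 0 < A / B := div_pos hA0 hB0
  refine (h (A / B) hρ).trans (le_of_eq ?_)
  have hX : 0 ≤ (A / B) ^ (1 - α) / (1 - α) := div_nonneg (Real.rpow_nonneg hρ.le _) h1α.le
  have hY : 0 ≤ (A / B) ^ (-α) / α := div_nonneg (Real.rpow_nonneg hρ.le _) hα0.le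
  have hc0 : 0 ≤ 1 / (1 - α) + 2 / α := by positivity
  have hL : ENNReal.ofReal K * (ENNReal.ofReal ((A / B) ^ (1 - α) / (1 - α)) * b +
      ENNReal.ofReal ((A / B) ^ (-α) / α) * (2 * a)) =
      ENNReal.ofReal (K * ((A / B) ^ (1 - α) / (1 - α) * B + (A / B) ^ (-α) / α * (2 * A))) := by
    rw [haA, hbB, ← ENNReal.ofReal_ofNat 2, ← ENNReal.ofReal_mul (by norm_num : (0 : ℝ) ≤ 2),
      ← ENNReal.ofReal_mul hX, ← ENNReal.ofReal_mul hY,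
      ← ENNReal.ofReal_add (mul_nonneg hX hB0.le) (mul_nonneg hY (by positivity)),
      ← ENNReal.ofReal_mul hK]
  have hR : ENNReal.ofReal (K * (1 / (1 - α) + 2 / α)) * a ^ (1 - α) * b ^ α =
      ENNReal.ofReal (K * (1 / (1 - α) + 2 / α) * A ^ (1 - α) * B ^ α) := by
    rw [haA, hbB, ENNReal.ofReal_rpow_of_pos hA0, ENNReal.ofReal_rpow_of_pos hB0,
      ← ENNReal.ofReal_mul (mul_nonneg hK hc0),
      ← ENNReal.ofReal_mul (mul_nonneg (mul_nonneg hK hc0) (Real.rpow_nonneg hA0.le _))]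
  rw [hL, hR]
  congr 1
  have hBα : B ^ α ≠ 0 := ne_of_gt (Real.rpow_pos_of_pos hB0 α)
  have hAα : A ^ α ≠ 0 := ne_of_gt (Real.rpow_pos_of_pos hA0 α)
  have e1 : (A / B) ^ (1 - α) * B = A ^ (1 - α) * B ^ α := by
    rw [Real.div_rpow hA0.le hB0.le, Real.rpow_sub hB0, Real.rpow_one]
    field_simp
  have e2 : (A / B) ^ (-α) * A = A ^ (1 - α) * B ^ α := by
    rw [Real.div_rpow hA0.le hB0.le, Real.rpow_neg hA0.le, Real.rpow_neg hB0.le, Real.rpow_sub hA0,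
      Real.rpow_one]
    field_simp
  calc K * ((A / B) ^ (1 - α) / (1 - α) * B + (A / B) ^ (-α) / α * (2 * A))
      = K * ((A / B) ^ (1 - α) * B / (1 - α) + 2 * ((A / B) ^ (-α) * A) / α) := by ring
    _ = K * (A ^ (1 - α) * B ^ α / (1 - α) + 2 * (A ^ (1 - α) * B ^ α) / α) := by rw [e1, e2]
    _ = K * (1 / (1 - α) + 2 / α) * A ^ (1 - α) * B ^ α := by ring

variable {d : Type*} [Fintype d]

/-- **Discharge of `Torus.fracLaplacian_moment_bound`** (Pazy 1983, §2.6, Thm. 6.10 (6.19) for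
`A = -Δ` on `L^p(T^d)`): for `0 < α < 1` and `1 < p < ∞` there is `C` (here
`C = I_α⁻¹(1/(1-α) + 2/α)`, `I_α = ∫₀^∞ t^{-1-α}(1 - e^{-t}) dt`, depending on `α` only) with
`‖(-Δ)^α u‖_{L^p} ≤ C ‖u‖_{L^p}^{1-α} ‖Δu‖_{L^p}^α` for every smooth `u : T^d → ℝ^d`
(`Torus.eLpNorm_fracLaplacian_le_of_pos` optimised in `ρ`). [cite: Pazy1983, §2.6 Thm. 6.10 (6.19)] -/
theorem fracLaplacian_moment_bound_holds : fracLaplacian_moment_bound d := by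
  classical
  intro α hα0 hα1 p hp hpt
  have hI0 : 0 < ∫ t in Ioi (0 : ℝ), t ^ (-1 - α) * (1 - Real.exp (-t)) := momentConst_pos hα0 hα1
  have hK : 0 ≤ (∫ t in Ioi (0 : ℝ), t ^ (-1 - α) * (1 - Real.exp (-t)))⁻¹ := inv_nonneg.2 hI0.le
  refine ⟨Real.toNNReal ((∫ t in Ioi (0 : ℝ), t ^ (-1 - α) * (1 - Real.exp (-t)))⁻¹ *
    (1 / (1 - α) + 2 / α)), fun u hu => ?_⟩
  exact le_rpow_mul_rpow_of_forall_pos hα0 hα1 hK (hu.memLp p).eLpNorm_ne_top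
    (hu.laplacian.memLp p).eLpNorm_ne_top
    (fun ρ hρ => eLpNorm_fracLaplacian_le_of_pos hα0 hα1 hp.le hpt.ne hu hρ)

end Discharge

end Torus

end Literature.Analysis.FluidPDE
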